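import Literature.NumberTheory.EllipticCurves.GrossPointsThetaElementFacts
import Literature.NumberTheory.EllipticCurves.IwasawaAlgebraProofs
import HarnessLib

/-!
# Theta elements of Gross points at a supersingular prime (`a_p = 0`): Darmon–Iovita's `L̃_n`, `L_n`
# and Pollack–Weston's theorem `μ(λ_f^±) = 0` (Compositio 147 (2011), Thm. 2.5)

Fifth file of the Gross-points story (`GrossPoints`, `GrossPointsPicardAction`,
`GrossPointsThetaElement`, `GrossPointsThetaElementFacts`); cite item `wi-88398` (family `bsd`,
consumer: route `SignedLowerHalves`, crux 2 = stmt-BirchSwinnertonDyer-19000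
`KobayashiLowerHalfSemistable`, line `defmu`, hard stub `stub_definitePackageMu` (Cμ): its conjunct
"unit content of the signed two-variable `𝓛` on the anticyclotomic line" is THIS theorem ⊕ a PRE
comparison (BSTW-II §2.3) that is not part of this file).

The previous files treat the ORDINARY case: Bertolini–Darmon's regularised theta elements
`θ_{n+1} = Σ_σ (α^{-(n+1)} y_{n+1}(σ) − α^{-(n+2)} y_n(σ̄)) σ⁻¹` (`GrossPointTower.theta`, `α` the
unit root) and Vatsal's theorem `μ(L_p(f, K)) = 0` in the finite-level form
`GrossPointTower.HasMuZeroAc` (`vatsal_hasMuZeroAc` = Pollack–Weston Thm. 2.3 (1)). When `a_p = 0`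
there is no unit root; Darmon–Iovita [DarmonIovita2008, §2.2] work instead with the UNREGULARISED
sums `L̃_n = Σ_{σ ∈ G̃_n} f(σ ⋆ v_n) σ⁻¹ ∈ ℤ_p[G̃_n]` (here `GrossPointTower.lTilde`), their
anticyclotomic images `L_n ∈ ℤ_p[G_n]`, `G_n = G̃_{n+1}/Δ` (here `GrossPointTower.lAc`), the
relation `π(L_{n+1}) = −ξ_n L_{n−1}` ((8), from `a_p = 0`), and extract the plus/minus `p`-adic
`L`-functions `L_f^± = lim_{n ≡ ±} L_n^±`, `L_n = ω̃_n^{∓} L_n^{±}` (Prop. 2.8, Lemma 2.9) — the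
`λ_f^±` of Pollack–Weston §2.4. Pollack–Weston's Theorem 2.5 (i), `μ(λ_f^±) = 0`, is proved by
the sentence "The arguments of [Vmu] in the ordinary case generalize immediately to show that
`μ(L_n) = 0` for `n` large enough. Since `μ(ω_n^±) = 0` for all `n`, we deduce that
`μ(λ_f^±) = 0`" — and `μ(L_n) = 0` for all large `n` is the form vendored here
(`GrossPointTower.HasMuZeroLAc`, the named fact `pollackWeston2011_thm_2_5_hasMuZeroLAc`), on the SAME
carrier and with the SAME hypotheses as `vatsal_hasMuZeroAc` (with `a_p(E) ∈ ℤ_pˣ` replaced by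
`a_p(E) = 0`, and Pollack–Weston's normalisation of `ψ_f` (Lemma 2.1) kept as an explicit
hypothesis).

## Sources, verbatim (read 2026-08-28; `lit read arxiv:math/0610694`, chunks 4–6; Darmon–Iovita
## from the authors' copy `paper:url-ac359b532900` = math.mcgill.ca/darmon/pub/Articles/Research/
## 39.Supersingular/paper.pdf, §§2.1–2.2 — the store's PDF under doi:10.1017/s1474748008000042 is
## a different paper (Bertolini–Darmon–Iovita on Teitelbaum's conjecture) and was not used)

* [PollackWeston2011] **Notation** (chunk 4): "Fix an odd prime `p` … Let `K/ℚ` be an imaginary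
  quadratic field with discriminant `D` prime to `p`. Let `K_∞` denote the anticyclotomic
  `ℤ_p`-extension of `K` … `Γ := Gal(K_∞/K)` … Let `f = Σ a_n q^n` denote a normalized newform of
  weight two, squarefree level `N = N⁺N⁻` prime to `pD`, and trivial nebentypus. We assume
  throughout this paper that `N⁻` has an odd number of prime factors. … `Λ := 𝒪[[Γ]]`."
  **§2.1** (chunk 5): "`ℳ = Pic(X_{N⁺,N⁻}) ⊗ ℤ_p` … one chooses a linear map `ψ_f : ℳ → 𝒪` that is
  `𝕋`-equivariant … By scaling by a constant of `𝒪`, we can and do insist that `1` be in the image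
  of `ψ_f`. … Let `ℳ^f` denote the submodule of `ℳ ⊗ 𝒪` on which `𝕋` acts via `π_f` … let `g_f`
  denote a generator … **Lemma 2.1.** There is some `m ∈ ℳ` such that `⟨m, g_f⟩` is a unit. …
  we may take `ψ_f(x) = ⟨x, g_f⟩`. … `ξ_f = ⟨g_f, g_f⟩`. **Lemma 2.2.** The period `Ω` in (1) can
  be taken to be `Ω = (f,f)/ξ_f`." **§2.2** (chunk 6): "`Ω_f := (f,f)/η_f` … (3)
  `L_f = λ_f · η_f(N)/ξ_f`." **§2.3**: "We normalize our `μ`-invariants so that `μ(Q)` for `Q ∈ Λ`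
  is the largest exponent `c` such that `Q ∈ 𝔭^c · Λ`." **§2.4 Supersingular case**: "Under the
  assumption that `a_p = 0`, two `p`-adic `L`-functions `λ_f^+, λ_f^- ∈ 𝒪[[Γ]]` are constructed in
  [DI] … defined with respect to the period `Ω` above; as before we denote by `L_f^±` the
  corresponding `p`-adic `L`-functions normalized with respect to the canonical period `Ω_f`. …
  **Theorem 2.5.** Let `f` be as above and assume that `a_p = 0`. Then: (i) `μ(λ_f^±) = 0`;
  (ii) `μ(L_f^±) = ord_𝔭(η_f/ξ_f)`. *Proof.* In [DI], the `p`-adic `L`-functions `λ_f^±` are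
  constructed via a sequence `{L_n}_{n ≥ 1}` (with `L_n ∈ 𝒪[Gal(K_n/K)]`) satisfying
  `π^n_{n−1} L_n = −ξ_{n−1} L_{n−2}`; here `π^n_{n−1} : 𝒪[Gal(K_n/K)] → 𝒪[Gal(K_{n−1}/K)]` is the
  natural map and `ξ_{n−1} = Σ_{σ ∈ Gal(K_{n−1}/K_{n−2})} σ`. It follows that `L_n` is divisible by
  `ω_n^ε` where `ω_n^+ = ∏_{1 ≤ k ≤ n, k even} ξ_k` and `ω_n^- = ∏_{1 ≤ k ≤ n, k odd} ξ_k`, and `ε`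
  equals the sign of `(−1)^{n−1}`. For a fixed parity of `n`, factoring out these extra zeroes
  then produces the norm compatible sequence that yields `λ_f^ε`. The arguments of [Vmu] in the
  ordinary case … generalize immediately to show that `μ(L_n) = 0` for `n` large enough. Since
  `μ(ω_n^±) = 0` for all `n`, we deduce that `μ(λ_f^±) = 0` as desired. The second part follows
  from (3)."
* [DarmonIovita2008] **§2.1**: `B` the definite quaternion algebra of discriminant `N⁻`, `R` an
  Eichler `ℤ[1/p]`-order of conductor `N⁺`, `Γ = ι(R^×) ⊂ GL₂(ℚ_p)` acting on the Bruhat–Tits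
  tree `𝒯`; "**Definition 2.1.** A modular form of weight 2 on `𝒱(𝒯)` for `Γ` is a `Γ`-invariant
  `ℤ_p`-valued function on `𝒱(𝒯)`"; **Thm. 2.2** (Jacquet–Langlands: an eigenform
  `f ∈ S₂(𝒱/Γ)_ℤ` with `T_ℓ f = a_ℓ(E) f`, unique up to a scalar); **Prop. 2.3**
  "`Σ_{v' ∼ v} f(v') = a_p(E) f(v)`"; "We normalize the form `f` so that it is not divisible by
  any integer in `S₂(𝒱/Γ)_ℤ`. This makes `f` well-defined up to a sign." **§2.2**: an embedding
  `Ψ : K → B` with `Ψ(K) ∩ R = Ψ(𝒪)` ("exists if and only if all the primes dividing `N⁺` are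
  split in `K`, while those dividing `N⁻` are inert in `K`"); vertices `v_n` at distance `n` from
  the geodesic (`p` split) / from `v_0` (`p` inert), with stabiliser `U_n`;
  "`f_{K,n}(σ) = f(σ ⋆ v_n)`"; "`L̃_n := Σ_{σ ∈ G̃_n} f_{K,n}(σ) σ⁻¹ ∈ ℤ_p[G̃_n]`" (Remark 2.5: in
  general `G̃_∞ = Gal` of the union of the ring class fields of `p`-power conductor, §3:
  "`G̃_m` is identified with `Gal(K̃_m/K)`, where `K̃_m` is the ring class field of conductor
  `p^m`"); **Lemma 2.6** "`π_{n+1,n}(L̃_{n+1}) = a_p(E) L̃_n − ξ̃_{n−1} L̃_{n−1}`. In particular, if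
  `p` is supersingular for `E` so that `a_p(E) = 0`, `π_{n+1,n}(L̃_{n+1}) = −ξ̃_{n−1} L̃_{n−1}` for
  all `n ≥ 1`"; "`G̃_∞ = Δ × G_∞`, where `Δ` is the torsion subgroup of `G̃_∞` and `G_∞ … ≃ ℤ_p` …
  `G_n := G̃_{n+1}/Δ ≃ ℤ/p^nℤ`. Let `ν : ℤ_p[G̃_{n+1}] → ℤ_p[G_n]` be the natural homomorphism …
  `L_n := ν(L̃_{n+1})`"; (8) "`π_{n+1,n}(L_{n+1}) = −ξ_n L_{n−1}` for all `n ≥ 1`"; `Λ = ℤ_p[[T]]`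
  after a topological generator `γ ↦ 1 + T`, `ℤ_p[G_n] = ℤ_p[T]/ω_n`, `ω_n = (T+1)^{p^n} − 1 =
  T ∏_{j=1}^n ξ_j(T)`, `ω̃_n^+ = ∏_{2 ≤ j ≤ n, j even} ξ_j`, `ω̃_n^- = ∏_{1 ≤ j ≤ n, j odd} ξ_j`,
  `ω_n^± = T ω̃_n^±`; **Lemma 2.7** (`ε = sgn (−1)^n`): "(1) Multiplication by `ω̃_n^{−ε}` induces
  a natural isomorphism `Λ/(ω_n^ε) → ω̃_n^{−ε}Λ/(ω_n)`. (2) For all `r ≥ 1`, multiplication by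
  `ω̃_n^{−ε}` induces a natural isomorphism `Λ/(ω_n^ε, p^r) → ω̃_n^{−ε}Λ/(ω_n, p^r)`";
  **Prop. 2.8** "(1) `ω_n^ε L_n = 0` (2) There is a unique element `L_n^ε ∈ Λ/ω_n^ε` such that
  `L_n = ω̃_n^{−ε} L_n^ε`"; `𝓛_n^+ = (−1)^{n/2} L_n^+` (`n` even), `𝓛_n^- = (−1)^{(n+1)/2} L_n^-`
  (`n` odd); **Lemma 2.9** (these are compatible under `Λ/ω_n^± → Λ/ω_{n−2}^±`);
  "`L_f^+ := lim 𝓛_n^+ ∈ lim Λ/ω_n^+ = Λ`, and define `L_f^-` similarly … `L_p(f, K) :=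
  L_f^ε (L_f^ε)^ι`."

## Dictionary (tree ↔ DI/PW) and rendering

* DI's vertices `σ ⋆ v_n` at distance `n` = Gross points of conductor `p^n` moved by
  `G̃_n = Pic(𝒪_{p^n})` (BD96 §2.3–2.4) = the tree's `σ • T.pt n` for a `GrossPointTower` `T`;
  DI's `f(σ ⋆ v_n)` = Pollack–Weston's `ψ_f(P_n^σ) = ⟨P_n^σ, g_f⟩` = the tree's
  `T.y p φ n σ = ⟨σ • x_n, φ⟩ = w_{[I]} φ_{[I]}` (file `GrossPoints`, "`ψ_f(x) = ⟨x, g_f⟩`"), with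
  `φ = g_f` a generator of the eigen-line `Brandt.eigenLattice … (a_n(E)) = ℤ φ` (divisor
  coordinates; `ℳ^f = ℤ_p ⊗ ℤφ` since the eigen-lattice is saturated). Hence
  `lTilde p φ T n = L̃_n` and `lAc p φ T n = L_n ∈ ℤ_p[G_n]`, `G_n = G̃_{n+1}/Δ =
  AcLayerGroup K p (n + 1)` (the indexing of `GrossPointTower.thetaAc`).
* PW's normalisation "`1 ∈ im ψ_f`" (their Lemma 2.1 for a generator `g_f`): `im ψ_f` is the ideal
  of `ℤ_p` generated by the values `ψ_f(e_c) = w_c φ_c`, so it reads `∃ c, p ∤ w_c φ_c`; it is KEPT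
  as a hypothesis (`vatsal_hasMuZeroAc` leaves it implicit; for `p ≥ 5` and primitive `φ` it only
  excludes `p ∣ gcd_c (w_c φ_c)`, `w_c ∈ {1,2,3,…}` dividing `12`).
* "`μ(Q) = max {c : Q ∈ 𝔭^c Λ}`" for `Q ∈ ℤ_p[G_n] = Λ/ω_n`: `μ(L_n) = 0` iff `L_n ∉ p ℤ_p[G_n]` iff
  some coefficient of `L_n` is a unit — `HasMuZeroLAc` asks this for all `n ≥ n₀`.
* **Why this is Theorem 2.5 (i)** (not merely a step of its proof): `L_n = ω̃_n^{−ε} L_n^ε` in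
  `Λ/ω_n` and `λ_f^ε ≡ ±L_n^ε (mod ω_n^ε)`; by Lemma 2.7 (2) (`r = 1`) multiplication by
  `ω̃_n^{−ε}` is injective `Λ/(ω_n^ε, p) → Λ/(ω_n, p)`, so `μ(L_n) = 0 ⟺ μ(L_n^ε) = 0`
  (`ε = sgn (−1)^n`); and `μ(λ_f^ε) = 0 ⟺ λ_f^ε ∉ 𝔭Λ = ⋂_n (𝔭, ω_n^ε) ⟺ L_n^ε ∉ 𝔭(Λ/ω_n^ε)` for
  one — equivalently (compatibility) every large — `n ≡ ε`. Both parities being cofinal,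
  `[μ(λ_f^+) = 0 ∧ μ(λ_f^-) = 0] ⟺ [μ(L_n) = 0 for all n ≫ 0] = HasMuZeroLAc`. The `Λ`-level
  objects themselves (`Λ ≅ lim ℤ_p[G_n]`, `L_n^±`, `λ_f^±`) are NOT constructed in the tree
  (documented gap of `GrossPointsThetaElement`: no `ℤ_p⟦T⟧ ≃ lim ℤ_p[G_n^{ac}]`); instead the
  PROVED transfer `HasMuZeroLAc.hasUnitContent_of_pinned` turns the fact into
  `GreenbergVatsal2000.HasUnitContent λ` for ANY power series `λ ∈ ℤ_p⟦T⟧` pinned to the `L_n`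
  through ring maps `ℤ_p⟦T⟧ → ℤ_p[G_n]` (`ρ_n(u_n λ) = unit · L_n` for cofinally many `n`) — which
  is how DI's `L_f^ε` sits over the `L_n` (`ρ_n(ω̃_n^{−ε} L_f^ε) = ±L_n`, Prop. 2.8) under any
  identification `Λ ≅ lim ℤ_p[G_n]`.
* **Thm. 2.5 (ii)** is (i) transported along the normalisation (3) `L_f^± = λ_f^± · η_f(N)/ξ_f`
  (`η_f(N)` = the tree's `ModularForms.congruenceNumber`, `ξ_f = ξ_f(N⁺,N⁻)` = `Brandt.XiSetup.xi`,
  cf. `RibetTakahashiDefinite.lean`); its content "`μ(c · L_n) = ord_p c` once `μ(L_n) = 0`" is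
  the proved `HasMuZeroLAc.forall_dvd_coeff_smul_iff`; no separate fact.
* For `f = f_E` (`𝒪 = ℤ_p`): hypotheses exactly as in `vatsal_hasMuZeroAc` — `p` odd, `K` imaginary
  quadratic, `N_E = N⁺N⁻` squarefree with `(N_E p, D_K) = 1`, `p ∤ N_E`, primes of `N⁺` split and
  of `N⁻` inert in `K`, `S` a Brandt setup of type `(N⁺, N⁻)` (so `ω(N⁻)` is odd), `φ` a generator
  of the `a(E)`-eigen-line — with "`a_p` a unit" replaced by `a_p(E) = W.LFunction p = 0`
  (`= W.frobeniusTrace p` at the good prime `p`, `LFunction_apply_prime_eq_frobeniusTrace`), plus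
  `ρ̄_{E,p}` irreducible ("`f` as above": Thm. 2.3's standing assumption; automatic at a
  supersingular `p`, kept so that nothing stronger than the printed theorem is asserted) and the
  Lemma 2.1 normalisation. TODO(general form): `𝒪 ⊋ ℤ_p` (non-rational newforms) — the Brandt
  module of the tree is `ℤ`-valued.

NOT vendored: DI Lemma 2.6 / (8) (the `a_p = 0` norm relation; it would be the supersingular twin
of the fact `grossPointTower_isNormCompatible`), Prop. 2.8–Lemma 2.9 (construction of `L_n^±`,
`L_f^±`), the interpolation property, DI Thm. 1.4 / PW Thm. 1.1 (ii) (main-conjecture and Selmer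
statements, which need `p` split in `K`; Thm. 2.5 does not). presearch (2026-08-28): tree — none
(`DarmonIovita`, `thm_2_5`, `HasMuZero`: only the ordinary `vatsal_hasMuZeroAc`); corpus hybrid /
vsearch ("anticyclotomic μ supersingular signed p-adic L-function") — only [PollackWeston2011]
itself; galaxy `"anticyclotomic mu-invariant|plus/minus p-adic L-functions|Darmon-Iovita"
--star all` — nothing relevant.

## References

* [PollackWeston2011] R. Pollack, T. Weston, *On anticyclotomic μ-invariants of modular forms*,
  Compos. Math. 147 (2011) 1353–1381, arXiv:math/0610694 — §1 Notation, §2.1 (Lemma 2.1, 2.2),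
  §2.2 (3), §2.3, §2.4 Thm. 2.5 with proof (read).
* [DarmonIovita2008] H. Darmon, A. Iovita, *The anticyclotomic Main Conjecture for elliptic curves
  at supersingular primes*, J. Inst. Math. Jussieu 7 (2008) 291–325 — §2.1 (Def. 2.1, Thm. 2.2,
  Prop. 2.3), §2.2 (L̃_n, Lemma 2.6, L_n, (8), Lemma 2.7, Prop. 2.8, Lemma 2.9) (read).
* [Vatsal2003] V. Vatsal, *Special values of anticyclotomic L-functions*, Duke Math. J. 116
  (2003), Thm. 1.1 (the ordinary `μ`-theorem whose argument PW extend; cited through PW).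
* [BertoliniDarmon1996] §2.3–2.7 (Gross points, `y_n`, theta elements; the tree's carrier).
-/

noncomputable section

open scoped nonZeroDivisors Matrix
open NumberField Literature.NumberTheory.Automorphic

universe u

namespace Literature.NumberTheory.EllipticCurves

/-! ### Darmon–Iovita's elements `L̃_n ∈ ℤ_p[G̃_n]` and `L_n ∈ ℤ_p[G_n]` -/

section Elements

variable {K : Type u} [Field K] [NumberField K] (p : ℕ) [Fact p.Prime] {Nplus Nminus : ℕ}
  {S : Brandt.XiSetup Nplus Nminus} (φ : Brandt.ClassSet S.O → ℤ) (T : GrossPointTower K S p)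

namespace GrossPointTower

open scoped Classical in
/-- **Darmon–Iovita's `L̃_n := Σ_{σ ∈ G̃_n} f(σ ⋆ v_n) σ⁻¹ ∈ ℤ_p[G̃_n]`** (the UNREGULARISED theta
element of level `n` of a tower of Gross points): `Σ_{σ ∈ Pic(𝒪_{p^n})} y_n(σ) σ⁻¹` with
`y_n(σ) = ⟨σ • x_n, φ⟩` (`GrossPointTower.y`; Pollack–Weston's `ψ_f(P_n^σ)`). No unit root enters,
so this is defined at every `p`; the ordinary `θ_{n+1}` of Bertolini–Darmon is
`α^{-(n+1)} L̃_{n+1} − α^{-(n+2)} (L̃_n pulled back)` (`theta_eq_smul_lTilde_sub`). Junk value `0`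
should the class group be infinite (it is finite, Neukirch I (12.12)). [cite: DarmonIovita2008, §2.2 (definition of L̃_n)] -/
def lTilde (n : ℕ) : MonoidAlgebra ℤ_[p] (ClassGroup (quadOrder K (p ^ n))) :=
  if h : Finite (ClassGroup (quadOrder K (p ^ n))) then
    letI := @Fintype.ofFinite (ClassGroup (quadOrder K (p ^ n))) h
    ∑ σ, MonoidAlgebra.single σ⁻¹ ((T.y p φ n σ : ℤ) : ℤ_[p])
  else 0

/-- `L̃_n = Σ_σ y_n(σ) σ⁻¹` for any enumeration of the (finite) class group (unfolding of the
printed definition "`L̃_n := Σ_{σ ∈ G̃_n} f_{K,n}(σ) σ⁻¹`"). [cite: DarmonIovita2008, §2.2 (definition of L̃_n)] -/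
theorem lTilde_eq_sum (n : ℕ) [Fintype (ClassGroup (quadOrder K (p ^ n)))] :
    T.lTilde p φ n = ∑ σ, MonoidAlgebra.single σ⁻¹ ((T.y p φ n σ : ℤ) : ℤ_[p]) := by
  rw [lTilde, dif_pos (Finite.of_fintype _)]
  congr!

/-- The coefficient of `g` in `L̃_n` is `y_n(g⁻¹) = f_{K,n}(g⁻¹)` (the involution `σ ↦ σ⁻¹` of the
printed definition "`L̃_n := Σ_{σ ∈ G̃_n} f_{K,n}(σ) σ⁻¹`"). [cite: DarmonIovita2008, §2.2 (definition of L̃_n)] -/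
theorem coeff_lTilde (n : ℕ) [Fintype (ClassGroup (quadOrder K (p ^ n)))]
    (g : ClassGroup (quadOrder K (p ^ n))) :
    (T.lTilde p φ n).coeff g = ((T.y p φ n g⁻¹ : ℤ) : ℤ_[p]) := by
  rw [lTilde_eq_sum, MonoidAlgebra.coeff_sum, Finsupp.finsetSum_apply,
    Finset.sum_eq_single_of_mem g⁻¹ (Finset.mem_univ _) fun σ _ hσ => ?_]
  · rw [MonoidAlgebra.coeff_single, inv_inv, Finsupp.single_eq_same]
  · rw [MonoidAlgebra.coeff_single, Finsupp.single_eq_of_ne]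
    exact fun h => hσ (by rw [h, inv_inv])

/-- **The ordinary theta element is the `α`-regularisation of `L̃`**:
`θ_{n+1} = α^{-(n+1)} L̃_{n+1} − α^{-(n+2)} Σ_{σ ∈ G̃_{n+1}} y_n(σ̄) σ⁻¹` (BD96 §2.5 (5):
`z_n = α^{-n} y_n − α^{-(n+1)} y_{n-1}`; the second sum is `L̃_n` pulled back along
`G̃_{n+1} → G̃_n`, i.e. "`ξ̃_n L̃_n` viewed in `ℤ_p[G̃_{n+1}]`" in Darmon–Iovita's notation). [cite: BertoliniDarmon1996, §2.5 (5)] -/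
theorem theta_eq_smul_lTilde_sub (α : ℤ_[p]ˣ) (n : ℕ)
    [Fintype (ClassGroup (quadOrder K (p ^ (n + 1))))] :
    T.theta p φ α n = ((α⁻¹ ^ (n + 1) : ℤ_[p]ˣ) : ℤ_[p]) • T.lTilde p φ (n + 1) -
      ((α⁻¹ ^ (n + 2) : ℤ_[p]ˣ) : ℤ_[p]) • ∑ σ : ClassGroup (quadOrder K (p ^ (n + 1))),
        MonoidAlgebra.single σ⁻¹
          ((T.y p φ n (picRes K (pow_dvd_pow p n.le_succ) σ) : ℤ) : ℤ_[p]) := by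
  rw [theta_eq_sum, lTilde_eq_sum, Finset.smul_sum, Finset.smul_sum, ← Finset.sum_sub_distrib]
  refine Finset.sum_congr rfl fun σ _ => ?_
  rw [MonoidAlgebra.smul_single', MonoidAlgebra.smul_single', ← MonoidAlgebra.single_sub]
  rfl

/-- **Darmon–Iovita's `L_n := ν(L̃_{n+1}) ∈ ℤ_p[G_n]`, `G_n = G̃_{n+1}/Δ`**: the image of `L̃_{n+1}`
in the group ring of the `(n+1)`-st anticyclotomic layer group `G̃_{n+1}/(image of Δ)`
(`AcLayerGroup K p (n + 1)`, the indexing of `GrossPointTower.thetaAc`). These satisfy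
`π_{n+1,n}(L_{n+1}) = −ξ_n L_{n−1}` when `a_p = 0` (DI (8), not vendored) and are Pollack–Weston's
"`L_n ∈ 𝒪[Gal(K_n/K)]`". [cite: DarmonIovita2008, §2.2 (definition of L_n and (8))] -/
def lAc (n : ℕ) : MonoidAlgebra ℤ_[p] (AcLayerGroup K p (n + 1)) :=
  MonoidAlgebra.mapDomainRingHom ℤ_[p] (acProj K p (n + 1)) (T.lTilde p φ (n + 1))

/-- **`μ(L_n) = 0` for all large `n`** ("`μ(Q)` the largest `c` with `Q ∈ 𝔭^c Λ`", PW §2.3; for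
`Q = L_n ∈ ℤ_p[G_n] = Λ/ω_n`: some coefficient of `L_n` is a `p`-adic unit): the finite-level form
of Pollack–Weston's `μ(λ_f^+) = 0 ∧ μ(λ_f^-) = 0` (the two signs are the two parities of `n`; see
the module docstring for the equivalence via DI Lemma 2.7 (2)). The sentence "`μ(L_n) = 0` for
`n` large enough" of the proof of PW Thm. 2.5. [cite: PollackWeston2011, §2.3 and proof of Thm. 2.5] -/
def HasMuZeroLAc : Prop :=
  ∃ n₀ : ℕ, ∀ n, n₀ ≤ n → ∃ g, IsUnit ((T.lAc p φ n).coeff g)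

variable {p φ T}

/-- Both signs: under `HasMuZeroLAc`, for each parity there are arbitrarily large `n` of that
parity with `μ(L_n) = 0` (`n` even ↔ `λ_f^+`, `n` odd ↔ `λ_f^-`: "For a fixed parity of `n`,
factoring out these extra zeroes then produces the norm compatible sequence that yields `λ_f^ε`").
[cite: PollackWeston2011, proof of Thm. 2.5] -/
theorem HasMuZeroLAc.frequently_of_parity (h : T.HasMuZeroLAc p φ) (ε : ℤˣ) (n₁ : ℕ) :
    ∃ n, n₁ ≤ n ∧ (-1 : ℤˣ) ^ n = ε ∧ ∃ g, IsUnit ((T.lAc p φ n).coeff g) := by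
  obtain ⟨n₀, hn₀⟩ := h
  rcases Int.units_eq_one_or ε with rfl | rfl
  · exact ⟨2 * (n₀ + n₁), by omega, (even_two_mul _).neg_one_pow, hn₀ _ (by omega)⟩
  · exact ⟨2 * (n₀ + n₁) + 1, by omega, (odd_two_mul_add_one _).neg_one_pow, hn₀ _ (by omega)⟩

/-- **Thm. 2.5 (ii) modulo the normalisation (3)**: once `μ(L_n) = 0`, the renormalised element
`c · L_n` (`c = η_f(N)/ξ_f ∈ ℤ_p` for the canonical period) satisfies `μ(c · L_n) = ord_p c`,
i.e. `d` divides every coefficient of `c · L_n` iff `d ∣ c`. [cite: PollackWeston2011, Thm. 2.5 (ii) and (3)] -/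
theorem HasMuZeroLAc.forall_dvd_coeff_smul_iff (h : T.HasMuZeroLAc p φ) :
    ∃ n₀ : ℕ, ∀ n, n₀ ≤ n → ∀ c d : ℤ_[p],
      (∀ g, d ∣ (c • T.lAc p φ n).coeff g) ↔ d ∣ c := by
  obtain ⟨n₀, hn₀⟩ := h
  refine ⟨n₀, fun n hn c d => ⟨fun hall => ?_, fun hdc g => ?_⟩⟩
  · obtain ⟨g, hg⟩ := hn₀ n hn
    have hdg := hall g
    rw [MonoidAlgebra.coeff_smul_apply, smul_eq_mul] at hdg
    exact (hg.dvd_mul_right).mp hdg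
  · rw [MonoidAlgebra.coeff_smul_apply, smul_eq_mul]
    exact hdc.mul_right _

/-- **Transfer to the Iwasawa algebra** (the consumer's currency): if `μ(L_n) = 0` for all large
`n` and a power series `λ ∈ ℤ_p⟦T⟧` is PINNED to the `L_n` — for cofinally many `n` some ring map
`ρ_n : ℤ_p⟦T⟧ → ℤ_p[G_n]` sends a multiple `u_n λ` to a unit multiple of `L_n` — then some
coefficient of `λ` is a unit, i.e. `μ(λ) = 0`. The conclusion is literally
`GreenbergVatsal2000.HasUnitContent λ` (`hasUnitContent_def`, file
`GreenbergVatsal2000/CongruentCurves` — deliberately NOT imported here: its import closure makes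
the instance search `Monoid (AcLayerGroup K p n)` exceed the default `synthInstance.maxHeartbeats`;
a consumer importing both should raise that option locally). This is the step "since
`μ(ω_n^±) = 0` … we deduce `μ(λ_f^±) = 0`" of PW's proof, for DI's `L_f^ε` under any
identification `Λ ≅ lim ℤ_p[G_n]` (`ρ_n(ω̃_n^{−ε} L_f^ε) = ±L_n` for `n ≡ ε`, Prop. 2.8 /
Lemma 2.9): if every coefficient of `λ` were a non-unit then `λ ∈ pℤ_p⟦T⟧`, so `L_n ∈ pℤ_p[G_n]`.
[cite: PollackWeston2011, proof of Thm. 2.5] -/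
theorem HasMuZeroLAc.hasUnitContent_of_pinned (h : T.HasMuZeroLAc p φ) {lam : PowerSeries ℤ_[p]}
    (ρ : ∀ n, PowerSeries ℤ_[p] →+* MonoidAlgebra ℤ_[p] (AcLayerGroup K p (n + 1)))
    (hpin : ∀ n₁, ∃ n, n₁ ≤ n ∧ ∃ (u : PowerSeries ℤ_[p]) (s : ℤ_[p]ˣ),
      ρ n (u * lam) = (s : ℤ_[p]) • T.lAc p φ n) :
    ∃ i : ℕ, IsUnit (PowerSeries.coeff i lam) := by
  obtain ⟨n₀, hn₀⟩ := h
  obtain ⟨n, hn, u, s, hρ⟩ := hpin n₀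
  obtain ⟨g, hg⟩ := hn₀ n hn
  by_contra hcon
  -- every coefficient of `lam` is a non-unit of `ℤ_p`, hence divisible by `p`
  have hdvd : ∀ i, (p : ℤ_[p]) ∣ PowerSeries.coeff i lam := fun i => by
    have hi : ¬ IsUnit (PowerSeries.coeff i lam) := fun hu => hcon ⟨i, hu⟩
    exact (PadicInt.norm_lt_one_iff_dvd _).mp (PadicInt.mem_nonunits.mp (mem_nonunits_iff.mpr hi))
  obtain ⟨lam', rfl⟩ : PowerSeries.C (p : ℤ_[p]) ∣ lam :=
    (PowerSeries.C_dvd_iff_forall_dvd_coeff _ _).mpr hdvd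
  -- so `s • L_n = ρ(u · p · lam') = p · ρ(u lam')`: the unit coefficient of `L_n` is divisible by `p`
  have hcoeff : ((s : ℤ_[p]) • T.lAc p φ n).coeff g = (p : ℤ_[p]) * (ρ n (u * lam')).coeff g := by
    rw [← hρ, mul_left_comm, map_natCast, map_mul, map_natCast, MonoidAlgebra.natCast_def,
      MonoidAlgebra.coeff_single_one_mul]
  rw [MonoidAlgebra.coeff_smul_apply, smul_eq_mul] at hcoeff
  have hpdvd : (p : ℤ_[p]) ∣ (T.lAc p φ n).coeff g := Units.dvd_mul_left.mp ⟨_, hcoeff⟩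
  exact (mem_nonunits_iff.mp PadicInt.p_nonunit) (isUnit_of_dvd_unit hpdvd hg)

end GrossPointTower

end Elements

/-! ### Pollack–Weston 2011, Theorem 2.5 (i): `μ(λ_f^±) = 0` at `a_p = 0` (named fact) -/

section Fact

variable (K : Type u) [Field K] [NumberField K] {Nplus Nminus : ℕ}
  (S : Brandt.XiSetup Nplus Nminus) (p : ℕ) [Fact p.Prime]

/-- **Pollack–Weston 2011, Thm. 2.5 (i) (`μ(λ_f^+) = μ(λ_f^-) = 0` for `a_p = 0`)**, for `f = f_E`,
in the finite-level form "`μ(L_n) = 0` for `n` large enough" of its proof (equivalent to the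
printed statement by Darmon–Iovita Lemma 2.7 (2), see the module docstring): let `p` be an odd
prime, `K` an imaginary quadratic field, `E/ℚ` (model `W`) an elliptic curve of square-free
conductor `N_E = N⁺N⁻` with `(N_E p, D_K) = 1`, `p ∤ N_E`, every prime of `N⁺` split and every
prime of `N⁻` inert in `K`, `S` a Brandt setup of type `(N⁺, N⁻)` (so `N⁻` has an odd number of
prime factors), `a_p(E) = 0` ("assume that `a_p = 0`") and `ρ̄_{E,p}` irreducible ("`f` as
above"); let `φ` be a generator of the `a(E)`-eigen-line of the Brandt module (Pollack–Weston's
`g_f`, `ψ_f = ⟨·, g_f⟩`) normalised as in their Lemma 2.1 (`1 ∈ im ψ_f`: some `w_c φ_c` is a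
`p`-adic unit). Then for every tower of Gross points of `p`-power conductor the Darmon–Iovita
elements `L_n = Σ_σ ψ_f(P_{n+1}^σ) σ⁻¹ ∈ ℤ_p[G̃_{n+1}/Δ]` — whose signed limits are the
anticyclotomic `p`-adic `L`-functions `λ_f^± ∈ Λ` of [DI]/PW §2.4 (Gross period `Ω = (f,f)/ξ_f`)
— are eventually not divisible by `p`. (Thm. 2.5 (ii), `μ(L_f^±) = ord_𝔭(η_f/ξ_f)` for the
canonical period, is (i) + the normalisation (3): `HasMuZeroLAc.forall_dvd_coeff_smul_iff`.)
The printed argument: Vatsal's proof of `μ = 0` [Vmu] "generalize[s] immediately". [cite: PollackWeston2011, Thm. 2.5 (i) and its proof (§2.4)] [cite: DarmonIovita2008, §2.2 Prop. 2.8] -/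
def pollackWeston2011_thm_2_5_hasMuZeroLAc (W : WeierstrassCurve ℚ) : Prop :=
  ∀ [W.IsElliptic] [Fintype (Brandt.ClassSet S.O)], IsImaginaryQuadratic K → p ≠ 2 →
    Nplus * Nminus = W.conductorNorm ℤ → Squarefree (Nplus * Nminus) →
    (Nplus * Nminus * p).Coprime (NumberField.discr K).natAbs → ¬ p ∣ Nplus * Nminus →
    (∀ ℓ : ℕ, ℓ.Prime → ℓ ∣ Nplus → ((Ideal.span {(ℓ : ℤ)}).primesOver (𝓞 K)).ncard = 2) →
    (∀ ℓ : ℕ, ℓ.Prime → ℓ ∣ Nminus → ((Ideal.span {(ℓ : ℤ)}).primesOver (𝓞 K)).ncard = 1) →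
    W.LFunction p = 0 → W.HasIrreducibleModPGaloisRep p →
    ∀ (φ : Brandt.ClassSet S.O → ℤ), φ ≠ 0 →
      Brandt.eigenLattice (Nplus * Nminus) (Brandt.matrix S.O) (fun n => W.LFunction n) = ℤ ∙ φ →
      (∃ c : Brandt.ClassSet S.O, ¬ (p : ℤ) ∣ (Brandt.weight S.O c : ℤ) * φ c) →
    ∀ T : GrossPointTower K S p, T.HasMuZeroLAc p φ

end Fact

end Literature.NumberTheory.EllipticCurves

end
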